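import Summits.QuantumFields.YangMills.Theorems.BalabanUVNodesN11NoExpansionNumericsAtThm1CCMW
import Summits.QuantumFields.YangMills.Theorems.BalabanUVNodesN11Sect3SupplyChainBorelBThm1PrintedOfSolvable
import Summits.QuantumFields.YangMills.Theorems.BalabanUVNodesN11CubeCoverRowOfNesting

/-!
# DAG node N11 — N11's ONE-TOKEN RESIDUAL `SupplyChainAt` ON THE K0-ROWS ROAD AT THE cR-LETTERED MEMBERS OF K1's WITNESS NUMERICS: every θ-LEVEL LETTER of the road
# (`2 ≤ cR`, the nesting `L·M₂ ∣ M`, the five numeric rows, admissibility) INHABITED AT ONCE at the all-numerics witness `θ₁₃(n_c, ε₂₉)`,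
# `n_c := {θ₁₅ᶜᶜᴹᵂ(j; γ)'s numerics with s2.cR := c}`, `c ≥ 2`, `γ ∈ ]0, γ₁₁ⁿᵘᵐ(L, j, N)]`; the `c := 1` member IS K1's witness of record (`rfl`)

HEADER — WORK-UNIT METADATA.  Cell `pub-ymgap`, YM-PLAN Track A (HUMAN RULING D-0062 ∕ D-0149 width seats), seat `pub-ymgap-dag-n11-w3` (g4; WIDTH SEAT 3∕4 on NODE n11 [B14]),
route `BalabanUVNodes` rev 25 (v1.7 `CoPH` key), item K1⁷ `StabilityBAtRecordR13SepCoPH` = stmt-QuantumFields-20542 (helper lane `--kind proof --supports 20542 --as helper`,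
count-neutral).  Sequel of this seat's p605914 `…N11NoExpansionNumerics` ∕ p608030 `…N11NoExpansionNumericsAtThm1CCMW` (the five numeric rows of the ZhPin-class no-expansion
𝐓-step as scalar conditions; the four γ-conditions and the explicit window `γ₁₁ⁿᵘᵐ(L, j, N)` at the CCM numerics SHAPE), over dag-n11-w1's
`…Sect3SupplyChainBorelBThm1PrintedOfSolvable` (★★★ `supplyChainAt_gaussPinH_of_supplierBorel_of_solvable`: N11's token at the named Gaussian certificate from K0's rows —
per run, `2 ≤ cR` displayed) and dag-n11-w4's `…CubeCoverRowOfNesting` (`cover_row_of_partCompat_of_nesting`: the cube cover from the run guard + `L·M₂ ∣ M`).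
[III] = [Balaban1988Convergent], [15] = [Balaban1985Variational], [B7] = [Balaban1985Averaging], [I] = [Balaban1987RG1], [IV] = [Balaban1989LargeFieldI].

WHY THIS FILE (dag-n11-d g14 LOCATED-cR, pub-ymgap INBOX 2026-08-28 I.30035; this seat's LOCATED-ROADMAP-cR I.32222).  On the K0-rows road of N11's no-expansion half (dag-n11-d g12∕g13's
ZhPin faces, dag-n11-w1's `SupplierBorel` column A–E, dag-n11-w4's cover ∕ guard rows, this seat's numerics) every θ-level letter except ONE is, after p605914–p613848, a
condition on the window letter `θ.γ` or on the nesting numeral — and that one, `hcR : 2 ≤ θ.s2.cR` (forced by [B7] Prop. 2's factor 2, `…N11ChiTopRegularity`), reads `2 ≤ 1`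
at EVERY witness of record (`Record12Numerics` :130 `cR := 1`, inherited by `theta13OfThm1CCMW`), so that no face of the road has ALL its θ-level letters inhabited at one
parameter of the tree (dag-n11-w1 G2-INDEX: «joint inhabitation … at one θ is NOT in the tree»).  This file supplies that parameter WITHOUT minting anything: the
all-numerics witness `theta13LiveOfNumerics F N n ε₂₉ ζ Rz Zt` (node00-def-K0a, `Node00/Record13LiveSelectorFamily`) AT THE TERM
`n := { stage12NumericsOfThm1CCMW F.L j γ ε₀ B₃ B₃' a₀ a₁ with s2 := { sect2NumericsOfThm1C F.L with cR := c } }` — K1's witness numerics with the located regularity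
constant a LETTER `c` (structure-update notation; dag-n11-d's option (b) «cR a letter like γ»).  §1: its `rfl` views, its sign window `Pos` for `0 < c`, and ★ at `c := 1`
the term IS `stage12NumericsOfThm1CCMW …` and the witness IS `theta13OfThm1CCMW F N j γ …` BY `rfl` (nothing of record is re-keyed).  §2: at any H-extension `θ` of
`θ₁₃(n_c, ε₂₉)` the letters — `2 ≤ θ.s2.cR` (⟸ `2 ≤ c`), the nesting `L·M₂ ∣ M` (⟸ `1 ≤ j`), the five numeric rows on every windowed run (⟸ the four γ-conditions, p608030
§2 VERBATIM: the Stage-7 part `ν` is `numerics7OfThm1CCM`, `c`-blind).  §3 ★★★: dag-n11-w1's per-run token face instantiated there — `SupplyChainAt (gaussPinH θ) p` from the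
key `θ.Provisos₁₃SepCoPH`, the run's window, the run guard `PartCompat₁₃ … p p.K`, K0's per-cube [15]-solvability along the run, and [III] §3's supplier with `SupplierBorel` —
NOTHING ELSE (`hcR`, `hdiv`∕`hcov`, `h3 hR hε hε3 hε2`, `hM₁`, `hle`, admissibility all DISCHARGED); ★★★ the same under «γ sufficiently small» QUANTIFIED (`∃ γ₁₁ⁿᵘᵐ > 0`,
p608030 §1).  So on the N11 side the cost of LOCATED-cR's re-pin is ZERO: whichever member `c ≥ 2` the definers choose, the road's endpoint is ready BY NAME; the K0 side
(the cR-reading letters of `Record13LettersOfThm1CCMW` at the member: `cR·ε_m ≤ a₁`, `B₃·cR·ε_m ≤ a₀`, the «C₀ sufficiently large» rows) is node00-def-K0a's ∕ dag-n21-c's.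

WHAT THIS FILE PROVES (0 `def`, 0 `sorry`, standard axioms; `c`, `γ` letters throughout).
§1 `ccmwCR_s2_cR` · `ccmwCR_ν` · `ccmwCR_γ` · `ccmwCR_τ9` · `ccmwCR_s2_lf` · ★ `ccmwCR_one` (`c := 1` ⇒ the term IS `stage12NumericsOfThm1CCMW`) · ★ `theta13LiveOfNumerics_ccmwCR_one`
   (at `c := 1` and K0b's residuals of record the witness IS `theta13OfThm1CCMW F N j γ …`) · `ccmwCR_pos` (`Stage12Numerics.Pos` ⟸ `8 ≤ L`-free signs: `1 ≤ L`, `0 < γ < 1`, `0 < c`, [15]'s).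
§1b ★ THE `c`-BLIND ROWS (`rfl`, at K0b's residual pins): `betaOfRecord₁₃_ccmwCR` (the β OF RECORD of the member IS `betaOfRecord₁₃ F N θ₁₅ᶜᶜᴹᵂ` — so K0⁷'s sign-free windowed
   β-box `hbox ∕ hbox′` of the door is the SAME hypothesis at the member) · `gOfRecord₁₃_ccmwCR` (the generated couplings, hence the window letter and every numeric row's input) ·
   `partCompat₁₃_ccmwCR_iff` (the run guard, `Iff.rfl`) · `ν_τ9_ccmwCR` (the Stage-7 dictionary and the tower numerics — hence K0's per-cube [15]-solvability row `hsolv` is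
   LITERALLY the row at `θ₁₅ᶜᶜᴹᵂ`) · `s2_cR_ccmwCR_and_witness` (the ONE Stage-13 field that reads `c`: `cR = c` vs `cR = 1`).  Reading: of the door's K0-side inputs
   (dag-n24-c Part 14 §0c: (8) `VariationalThm1RegSepCoP7M`, the R (9)-step `Gauge9RegSepTopStepR`, the β-box with its two letters, the six signs) NONE reads `c`; what reads `c`
   is row `bg`'s support `suppOfRecord₁₃SepCoP` and the cR-reading letters of `Record13LettersOfThm1CCMW` ((hnum), the «C₀ sufficiently large» rows) — definers' to re-derive.
§2 at any `θ : Stage13HParams` with `θ.toStage13Params = theta13LiveOfNumerics F N n_c ε₂₉ ζ Rz Zt`: `two_le_cR_of_ccmwCRH` · `nesting_of_ccmwCRH` (`F.L·M₂ ∣ M` ⟸ `1 ≤ j`) ·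
   ★★ `numericRows_of_ccmwCRH` (the five rows on every windowed run from the four γ-conditions).
§3 ★★★ `supplyChainAt_gaussPinH_of_ccmwCRH_of_supplierBorel_of_solvable` · ★★★ `exists_window_supplyChainAt_gaussPinH_of_ccmwCRH` (∃ `γ₁₁ⁿᵘᵐ(L, j, N) > 0`: for every
   `γ ∈ ]0, γ₁₁ⁿᵘᵐ]`, every `c ≥ 2`, every H-extension, every run in the window: the token from key + guard + solvability + supplier) · ★★★
   `thmP245Laws_gaussPinH_of_ccmwCRH_of_supplierBorel_of_solvable` (per run: THEOREM 1 OF [III] `∀ k ≤ K, SLaw₁₃CoPH (gaussPinH θ) p k` AND the theorem of p. 245 in law form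
   `∀ k < K, SLaw → TLaw` — dag-n11-e's `sLaw₁₃CoPH_all_of_supplyChainAt` ∕ `thmP245Laws_of_supplyChainAt` on the live-selector line, selector `rfl`, `κ = 2·10⁴`, `E₀ = B₀ = 1`,
   `M = L^j ≥ 1`; the road-(b) twin, at a parameter where `2 ≤ cR` HOLDS, of dag-n11-e's road-(a) §3c deliverable p606248 at `θ₁₅ᶜᶜᴹᵂ`).

HONEST FRAMING ∕ A6.  Helper lane, count-neutral KERNEL BOOKKEEPING (structure-update `rfl`s, elementary arithmetic, ONE application of dag-n11-w1's face); nothing of Bałaban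
([III] ∕ [15] ∕ [B7] ∕ [I]) is asserted.  INHABITED here (kernel): `2 ≤ cR`, the nesting, the five numeric rows, `Pos`∕admissibility — jointly, at one θ.  DISPLAYED (hypotheses,
NOT discharged): the key `θ.Provisos₁₃SepCoPH` AT THE MEMBER (K0⁷'s registered stubs and node00-def's door letters are keyed at the `c := 1` member `θ₁₅ᶜᶜᴹ(ᵂ)` — at `c ≥ 2`
the cR-reading letters are the definers' to re-derive; this file asserts none of them), the per-run guard `PartCompat₁₃ … p p.K` (dag-n11-w4 g3∕g4: a FLOOR on `g_K`, NOT a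
consequence of the one-sided window — it stays a per-run letter here, never a `∀`-window binder), K0's per-cube [15]-solvability, [III] §3's supplier (`SupplierObligations`,
`SupplierBorel` — nobody's theorem today).  NOT a re-pin of any witness of record: NOTHING is minted (no `def`); the numerals are node00-def-K0a ∕ dag-n21-c's displayed choices
with ONE field a letter; the `c := 1` member is K1's witness BY `rfl`.  N11 NOT discharged; K1⁷ NOT closed, no stub touched; counts unmoved (typed 28∕28 · discharged 5∕27 ·
A 5∕28).  One finite `𝕋⁴_{L^K}` programme at fixed `ε = L^{−K}`; `route-QuantumFields-BalabanUVNodes` closes ONLY the CONDITIONAL finite-𝕋⁴ rung `BalabanLadder.UV` — NOT ℝ⁴,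
NOT OS, NOT the Yang–Mills mass gap (Clay).  No `sorry`, no `axiom`, no `def`, no `instance`, no `notation`.
Sources (SHAPE only): [III] Theorem p.245, Thm 1 p.262, §3 p.279, (2.4)–(2.5) p.255, (2.10) p.256 («|∂V_{j−1} − 1| < O(L²)ε_{j−1}» — the located constant), (2.13) pp.256–257,
(2.16)–(2.17) p.257, (3.24)–(3.25) p.270; [B7] Prop. 2 p.26; [I] Thm 1 p.259 (the window); [15] Thm 1 (7)–(10) p.279 (the signs of `B₃, B₃′, a₀, a₁`); [IV] (0.3)–(0.4) p.176.
-/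

noncomputable section

open MeasureTheory
open scoped BigOperators ENNReal NNReal Matrix.Norms.L2Operator

namespace Summit.QuantumFields.YangMills.Theorems.BalabanUVNodesN11SupplyChainAtCRLetteredNumerics

open Literature.MathematicalPhysics.QuantumFieldTheory.Balaban1983to89 T4Continuum T4NestedCovariance Node00 Node00.Tk DagBinding
open B15DeterminingSets B8Eq17ClassAkV1 B14.Eq218Concrete B10Eq42TorusConstraint
open B14.Eq213MaximalDomains (side)
open B14.Eq213DetSet (Bj)
open Literature.MathematicalPhysics.QuantumFieldTheory.BalabanImbrieJaffe1984to88.BIJ85Eq453GaugeField (qsstarGIter0)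
open BalabanUVNodesN11GaussianCertificateDefs (gaussPinH provisos₁₃CoPH_gaussPinH)
open BalabanUVNodesN11Sect3SupplyChainDefs
open BalabanUVNodesN11Sect3SupplyChainBorelB
open BalabanUVNodesN11Sect3SupplyChainObligationsDefs
open BalabanUVNodesN11Sect3SupplyChainBorelBThm1PrintedOfSolvable (supplyChainAt_gaussPinH_of_supplierBorel_of_solvable)
open BalabanUVNodesN11CubeCoverRowOfNesting (cover_row_of_partCompat_of_nesting)
open BalabanUVNodesN11NoExpansionNumerics (hε_of_window)
open BalabanUVNodesN11NoExpansionNumericsAtThm1CCMW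

/-! ## §1  The cR-lettered numerics TERM `n_c := {θ₁₅ᶜᶜᴹᵂ(j; γ)'s numerics with s2.cR := c}` — `rfl` views, the `c := 1` member, the sign window -/

section Numerics

variable (L j : ℕ) (γ c ε₀ B₃ B₃' a₀ a₁ : ℝ)

/-- Its located regularity constant IS the letter `c` (`rfl`). [cite: Balaban1988Convergent, (2.10) p.256 (bookkeeping)] -/
theorem ccmwCR_s2_cR :
    ({ stage12NumericsOfThm1CCMW L j γ ε₀ B₃ B₃' a₀ a₁ with s2 := { sect2NumericsOfThm1C L with cR := c } } : Stage12Numerics).s2.cR = c := rfl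

/-- Its Stage-7 dictionary IS the collared member's `numerics7OfThm1CCM` (`rfl`; `c`-blind: `M₁ = L^j`, `M₂ = r = p₀ = 1`, `A₀ = A₀ᶜᶜ¹`, `εreg = a₀`).
[cite: Balaban1988Convergent, (2.4)–(2.5) p.255 (bookkeeping)] -/
theorem ccmwCR_ν :
    ({ stage12NumericsOfThm1CCMW L j γ ε₀ B₃ B₃' a₀ a₁ with s2 := { sect2NumericsOfThm1C L with cR := c } } : Stage12Numerics).ν = numerics7OfThm1CCM L j ε₀ B₃ B₃' a₀ a₁ :=
  rfl

/-- Its window constant IS `γ` (`rfl`). [cite: Balaban1987RG1, Thm 1 p.259 (bookkeeping)] -/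
theorem ccmwCR_γ : ({ stage12NumericsOfThm1CCMW L j γ ε₀ B₃ B₃' a₀ a₁ with s2 := { sect2NumericsOfThm1C L with cR := c } } : Stage12Numerics).γ = γ := rfl

/-- Its tower numerics ARE the collared member's (`rfl`; `τ9.M = L^j`). [cite: Balaban1989LargeFieldI, (2.1) p.182 (bookkeeping)] -/
theorem ccmwCR_τ9 :
    ({ stage12NumericsOfThm1CCMW L j γ ε₀ B₃ B₃' a₀ a₁ with s2 := { sect2NumericsOfThm1C L with cR := c } } : Stage12Numerics).τ9 = towerNumericsOfThm1CCM L j := rfl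

/-- Its term constants ARE the family's (`rfl`; `c`-blind). [cite: Balaban1988Convergent, (2.28) p.259 (bookkeeping)] -/
theorem ccmwCR_s2_lf :
    ({ stage12NumericsOfThm1CCMW L j γ ε₀ B₃ B₃' a₀ a₁ with s2 := { sect2NumericsOfThm1C L with cR := c } } : Stage12Numerics).s2.lf = lfConstsOfFamily := rfl

/-- **★ THE `c := 1` MEMBER IS K1's WITNESS NUMERICS** `stage12NumericsOfThm1CCMW L j γ ε₀ B₃ B₃' a₀ a₁` — BY `rfl` (nothing of record re-keyed).
[cite: Balaban1988Convergent, (2.10) p.256 (bookkeeping)] -/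
theorem ccmwCR_one :
    ({ stage12NumericsOfThm1CCMW L j γ ε₀ B₃ B₃' a₀ a₁ with s2 := { sect2NumericsOfThm1C L with cR := 1 } } : Stage12Numerics) =
      stage12NumericsOfThm1CCMW L j γ ε₀ B₃ B₃' a₀ a₁ := rfl

/-- **★ AT `c := 1` AND K0b's RESIDUALS OF RECORD THE WITNESS IS `θ₁₅ᶜᶜᴹᵂ(j; γ) = theta13OfThm1CCMW F N j γ …`** — BY `rfl`.
[cite: Balaban1989LargeFieldI, (0.3) p.176; Balaban1988Convergent, (2.10) p.256 (bookkeeping)] -/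
theorem theta13LiveOfNumerics_ccmwCR_one (F : T4Family) (N : ℕ) [NeZero N] (j : ℕ) (γ ε₀ ε₂₉ B₃ B₃' a₀ a₁ : ℝ) :
    theta13LiveOfNumerics F N ({ stage12NumericsOfThm1CCMW F.L j γ ε₀ B₃ B₃' a₀ a₁ with s2 := { sect2NumericsOfThm1C F.L with cR := 1 } } : Stage12Numerics) ε₂₉
        (zeta316OfRecord F N (stage12NumericsOfThm1CCMW F.L j γ ε₀ B₃ B₃' a₀ a₁).ν (stage12NumericsOfThm1CCMW F.L j γ ε₀ B₃ B₃' a₀ a₁).τ9.M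
          (stage12NumericsOfThm1CCMW F.L j γ ε₀ B₃ B₃' a₀ a₁).A₁)
        (RzOfRecord F N) (ZtOfRecord F N) =
      theta13OfThm1CCMW F N j γ ε₀ ε₂₉ B₃ B₃' a₀ a₁ := rfl

variable {L j γ c ε₀ B₃ B₃' a₀ a₁}

/-- **THE cR-LETTERED NUMERICS MEET EVERY SIGN WINDOW** (`Stage12Numerics.Pos`) under `1 ≤ L`, `0 < γ < 1`, `0 < c` and [15]'s signs — the collared member's `Pos`
with the one clause `0 < cR` re-read at the letter. [cite: Balaban1988Convergent, (2.4) p.255, (2.10) p.256, (2.28) p.259; Balaban1987RG1, Thm 1 p.259; Balaban1985Variational, Thm 1 p.279 (bookkeeping)] -/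
theorem ccmwCR_pos (hL : 1 ≤ L) (hγ0 : 0 < γ) (hγ1 : γ < 1) (hc : 0 < c) (hε : 0 < ε₀) (hB : 0 ≤ B₃) (hB' : 0 ≤ B₃') (ha₀ : 0 < a₀) (ha₁ : 0 < a₁) :
    ({ stage12NumericsOfThm1CCMW L j γ ε₀ B₃ B₃' a₀ a₁ with s2 := { sect2NumericsOfThm1C L with cR := c } } : Stage12Numerics).Pos := by
  obtain ⟨h1, h2, h3, h4, h5, h6, -, h8, h9⟩ := stage12NumericsOfThm1CCMW_pos (j := j) hL hγ0 hγ1 hε hB hB' ha₀ ha₁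
  exact ⟨h1, h2, h3, h4, h5, h6, hc, h8, h9⟩

end Numerics

/-! ### §1b  ★ THE c-BLIND ROWS (`rfl`): at the record pins the β OF RECORD, the GENERATED COUPLINGS, the RUN GUARD and K0's SOLVABILITY ROW of the member ARE those of
K1's witness `θ₁₅ᶜᶜᴹᵂ(j; γ)` — so K0⁷'s sign-free windowed β-box (`hbox ∕ hbox′` of the door), the window, `PartCompat₁₃` and the per-cube [15]-solvability row do NOT read `c` -/

section Blind

variable (F : T4Family) (N : ℕ) [NeZero N] (j : ℕ) (γ c ε₀ ε₂₉ B₃ B₃' a₀ a₁ : ℝ)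

/-- **★ THE β OF RECORD IS `c`-BLIND** (`rfl`): at K0b's residual pins the member's `betaOfRecord₁₃` IS `betaOfRecord₁₃ F N θ₁₅ᶜᶜᴹᵂ(j; γ)` — hence K0⁷'s (sign-free, windowed)
β-box hypotheses of the door (`BetaLowerH ∕ BetaUpperH … (betaOfRecord₁₃ F N θ₁₅ᶜᶜᴹᵂ)`, dag-n24-c Part 14 §0c) are the SAME hypotheses at the member.
[cite: Balaban1987RG1, (1.20)–(1.22) p.264; Balaban1988Convergent, (2.6)–(2.8) pp.255–256 (bookkeeping)] -/
theorem betaOfRecord₁₃_ccmwCR :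
    betaOfRecord₁₃ F N (theta13LiveOfNumerics F N
        ({ stage12NumericsOfThm1CCMW F.L j γ ε₀ B₃ B₃' a₀ a₁ with s2 := { sect2NumericsOfThm1C F.L with cR := c } } : Stage12Numerics) ε₂₉
        (zeta316OfRecord F N (stage12NumericsOfThm1CCMW F.L j γ ε₀ B₃ B₃' a₀ a₁).ν (stage12NumericsOfThm1CCMW F.L j γ ε₀ B₃ B₃' a₀ a₁).τ9.M
          (stage12NumericsOfThm1CCMW F.L j γ ε₀ B₃ B₃' a₀ a₁).A₁) (RzOfRecord F N) (ZtOfRecord F N)) =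
      betaOfRecord₁₃ F N (theta13OfThm1CCMW F N j γ ε₀ ε₂₉ B₃ B₃' a₀ a₁) := rfl

/-- **★ THE GENERATED COUPLINGS ARE `c`-BLIND** (`rfl`): `gOfRecord₁₃` of the member IS `gOfRecord₁₃ F N θ₁₅ᶜᶜᴹᵂ(j; γ)` on every run — so the window letter
`Step.InInterval γ …` and every numeric row read the same history. [cite: Balaban1987RG1, (0.20) p.256, §1 p.264 (bookkeeping)] -/
theorem gOfRecord₁₃_ccmwCR (p : B12.RunParams) :
    gOfRecord₁₃ F N (theta13LiveOfNumerics F N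
        ({ stage12NumericsOfThm1CCMW F.L j γ ε₀ B₃ B₃' a₀ a₁ with s2 := { sect2NumericsOfThm1C F.L with cR := c } } : Stage12Numerics) ε₂₉
        (zeta316OfRecord F N (stage12NumericsOfThm1CCMW F.L j γ ε₀ B₃ B₃' a₀ a₁).ν (stage12NumericsOfThm1CCMW F.L j γ ε₀ B₃ B₃' a₀ a₁).τ9.M
          (stage12NumericsOfThm1CCMW F.L j γ ε₀ B₃ B₃' a₀ a₁).A₁) (RzOfRecord F N) (ZtOfRecord F N)) p =
      gOfRecord₁₃ F N (theta13OfThm1CCMW F N j γ ε₀ ε₂₉ B₃ B₃' a₀ a₁) p := rfl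

/-- **★ THE RUN GUARD IS `c`-BLIND** (`Iff.rfl`): `PartCompat₁₃` of the member at `(p, n)` IS `PartCompat₁₃ F N θ₁₅ᶜᶜᴹᵂ(j; γ) p n` — dag-n11-w4's coupling-floor reading
(p608879 `partCompat₁₃_theta13OfThm1CCMW_iff`) applies verbatim. [cite: Balaban1988Convergent, (2.1) p.254, p.257 («all partitions are compatible») (bookkeeping)] -/
theorem partCompat₁₃_ccmwCR_iff (p : B12.RunParams) (n : ℕ) :
    PartCompat₁₃ F N (theta13LiveOfNumerics F N
        ({ stage12NumericsOfThm1CCMW F.L j γ ε₀ B₃ B₃' a₀ a₁ with s2 := { sect2NumericsOfThm1C F.L with cR := c } } : Stage12Numerics) ε₂₉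
        (zeta316OfRecord F N (stage12NumericsOfThm1CCMW F.L j γ ε₀ B₃ B₃' a₀ a₁).ν (stage12NumericsOfThm1CCMW F.L j γ ε₀ B₃ B₃' a₀ a₁).τ9.M
          (stage12NumericsOfThm1CCMW F.L j γ ε₀ B₃ B₃' a₀ a₁).A₁) (RzOfRecord F N) (ZtOfRecord F N)) p n ↔
      PartCompat₁₃ F N (theta13OfThm1CCMW F N j γ ε₀ ε₂₉ B₃ B₃' a₀ a₁) p n := Iff.rfl

/-- **★ THE STAGE-7 DICTIONARY AND THE TOWER NUMERICS OF THE MEMBER's STAGE-13 PART ARE THOSE OF `θ₁₅ᶜᶜᴹᵂ(j; γ)`** (`rfl`) — with `gOfRecord₁₃_ccmwCR` this makes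
K0's per-cube [15]-solvability row `hsolv` (which reads `ν`, `τ9.M` and the generated couplings only) LITERALLY the row at K1's witness: K0⁷'s print-stub territory
([15] Thm 1's existence half) is asked ONCE for both. [cite: Balaban1985Variational, Thm 1 (7)–(8) pp.278–279; Balaban1988Convergent, (2.16)–(2.17) p.257 (bookkeeping)] -/
theorem ν_τ9_ccmwCR :
    (theta13LiveOfNumerics F N
        ({ stage12NumericsOfThm1CCMW F.L j γ ε₀ B₃ B₃' a₀ a₁ with s2 := { sect2NumericsOfThm1C F.L with cR := c } } : Stage12Numerics) ε₂₉
        (zeta316OfRecord F N (stage12NumericsOfThm1CCMW F.L j γ ε₀ B₃ B₃' a₀ a₁).ν (stage12NumericsOfThm1CCMW F.L j γ ε₀ B₃ B₃' a₀ a₁).τ9.M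
          (stage12NumericsOfThm1CCMW F.L j γ ε₀ B₃ B₃' a₀ a₁).A₁) (RzOfRecord F N) (ZtOfRecord F N)).ν = (theta13OfThm1CCMW F N j γ ε₀ ε₂₉ B₃ B₃' a₀ a₁).ν ∧
    (theta13LiveOfNumerics F N
        ({ stage12NumericsOfThm1CCMW F.L j γ ε₀ B₃ B₃' a₀ a₁ with s2 := { sect2NumericsOfThm1C F.L with cR := c } } : Stage12Numerics) ε₂₉
        (zeta316OfRecord F N (stage12NumericsOfThm1CCMW F.L j γ ε₀ B₃ B₃' a₀ a₁).ν (stage12NumericsOfThm1CCMW F.L j γ ε₀ B₃ B₃' a₀ a₁).τ9.M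
          (stage12NumericsOfThm1CCMW F.L j γ ε₀ B₃ B₃' a₀ a₁).A₁) (RzOfRecord F N) (ZtOfRecord F N)).τ9 = (theta13OfThm1CCMW F N j γ ε₀ ε₂₉ B₃ B₃' a₀ a₁).τ9 :=
  ⟨rfl, rfl⟩

/-- **★ THE ONE STAGE-13 FIELD THAT READS `c`**: the member's `s2.cR` is `c` while `θ₁₅ᶜᶜᴹᵂ`'s is `1` (both `rfl`) — the support `suppOfRecord₁₃SepCoP` of row `bg` and N11's
`RegOn`∕junction constant are the only readers (dag-n11-d g14 LOCATED-cR census). [cite: Balaban1988Convergent, (2.10) p.256 (bookkeeping)] -/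
theorem s2_cR_ccmwCR_and_witness :
    (theta13LiveOfNumerics F N
        ({ stage12NumericsOfThm1CCMW F.L j γ ε₀ B₃ B₃' a₀ a₁ with s2 := { sect2NumericsOfThm1C F.L with cR := c } } : Stage12Numerics) ε₂₉
        (zeta316OfRecord F N (stage12NumericsOfThm1CCMW F.L j γ ε₀ B₃ B₃' a₀ a₁).ν (stage12NumericsOfThm1CCMW F.L j γ ε₀ B₃ B₃' a₀ a₁).τ9.M
          (stage12NumericsOfThm1CCMW F.L j γ ε₀ B₃ B₃' a₀ a₁).A₁) (RzOfRecord F N) (ZtOfRecord F N)).s2.cR = c ∧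
    (theta13OfThm1CCMW F N j γ ε₀ ε₂₉ B₃ B₃' a₀ a₁).s2.cR = 1 := ⟨rfl, rfl⟩

end Blind

/-! ## §2  The θ-level letters of the K0-rows road at any H-extension of `θ₁₃(n_c, ε₂₉)` -/

section Letters

variable {F : T4Family} {N : ℕ} [NeZero N]
variable {j : ℕ} {γ c ε₀ ε₂₉ B₃ B₃' a₀ a₁ : ℝ}
  {ζ : ZetaOfRecord F N (stage12NumericsOfThm1CCMW F.L j γ ε₀ B₃ B₃' a₀ a₁).ν (stage12NumericsOfThm1CCMW F.L j γ ε₀ B₃ B₃' a₀ a₁).τ9.M}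
  {Rz : (K : ℕ) → Sect2.Residual (F.P K) (MatA N)} {Zt : (K : ℕ) → TkResidualW F N (FluctV N) K}
  {θ : Stage13HParams F N}

/-- **`2 ≤ cR` AT THE MEMBER** (⟸ `2 ≤ c`): the one letter of the road that fails at every witness of record holds here. [cite: Balaban1988Convergent, (2.10) p.256; Balaban1985Averaging, Prop. 2 p.26 (bookkeeping)] -/
theorem two_le_cR_of_ccmwCRH
    (hθ : θ.toStage13Params = theta13LiveOfNumerics F N
      ({ stage12NumericsOfThm1CCMW F.L j γ ε₀ B₃ B₃' a₀ a₁ with s2 := { sect2NumericsOfThm1C F.L with cR := c } } : Stage12Numerics) ε₂₉ ζ Rz Zt)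
    (hc : 2 ≤ c) : 2 ≤ θ.s2.cR := by
  obtain ⟨⟨θ₁, Zr⟩, Zh, Phih⟩ := θ
  obtain rfl : θ₁ = _ := hθ
  exact hc

/-- **THE NESTING `L·M₂ ∣ M` AT THE MEMBER** (`M₂ = 1`, `M = L^j`, `1 ≤ j`) — dag-n11-w4's cube-cover input. [cite: Balaban1988Convergent, (2.1) p.254, (2.17) p.257 (bookkeeping)] -/
theorem nesting_of_ccmwCRH
    (hθ : θ.toStage13Params = theta13LiveOfNumerics F N
      ({ stage12NumericsOfThm1CCMW F.L j γ ε₀ B₃ B₃' a₀ a₁ with s2 := { sect2NumericsOfThm1C F.L with cR := c } } : Stage12Numerics) ε₂₉ ζ Rz Zt)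
    (hj : 1 ≤ j) (p : B12.RunParams) : (F.P p.K).L * θ.ν.M₂ ∣ θ.τ9.M := by
  obtain ⟨⟨θ₁, Zr⟩, Zh, Phih⟩ := θ
  obtain rfl : θ₁ = _ := hθ
  show F.L * 1 ∣ F.L ^ j
  rw [mul_one]
  exact dvd_pow_self _ (by omega)

/-- **★★ THE FIVE NUMERIC ROWS OF THE NO-EXPANSION 𝐓-STEP AT THE MEMBER, ON EVERY RUN IN THE WINDOW `]0, γ]`, EVERY LEVEL, FROM THE FOUR γ-CONDITIONS** — p608030 §2 VERBATIM
(the Stage-7 part is `numerics7OfThm1CCM`, `c`-blind: `M₁ = L^j`, `M₂ = r = p₀ = 1`, `0 < A₀ᶜᶜ¹ ≤ 1∕16`).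
[cite: Balaban1988Convergent, (2.4)–(2.5) p.255, (2.13) pp.256–257, (2.17) p.257; Balaban1985Averaging, Prop. 2 p.26; Balaban1987RG1, Thm 1 p.259; Balaban1985Variational, Thm 1 (7)–(10) p.279 (bookkeeping)] -/
theorem numericRows_of_ccmwCRH
    (hθ : θ.toStage13Params = theta13LiveOfNumerics F N
      ({ stage12NumericsOfThm1CCMW F.L j γ ε₀ B₃ B₃' a₀ a₁ with s2 := { sect2NumericsOfThm1C F.L with cR := c } } : Stage12Numerics) ε₂₉ ζ Rz Zt)
    (hB : 0 ≤ B₃) (hB' : 0 ≤ B₃') (ha₀ : 0 < a₀) (ha₁ : 0 < a₁) (hγ0 : 0 < γ) (hγe : γ ≤ Real.exp (-1))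
    (h3γ : 3 * (F.L : ℝ) ^ j ≤ F.L * Real.log (γ ^ 2)⁻¹) (hRγ : ((8 * F.L + 3 : ℕ) : ℝ) ≤ F.L * Real.log (γ ^ 2)⁻¹)
    (hε3γ : 36608 * (γ * Real.log (γ ^ 2)⁻¹) ≤ 16 / 3) (hε2γ : γ * Real.log (γ ^ 2)⁻¹ ≤ 16 * ExpMeanLog.deltaSU (Fin N) / ((8 * F.L : ℕ) : ℝ) ^ 2)
    (p : B12.RunParams) {k : ℕ} (hw : Step.InInterval γ k (gOfRecord₁₃ F N θ.toStage13Params p)) :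
      (∀ i, 1 ≤ i → i ≤ k →
          3 * side (F.P p.K).L θ.ν.M₁ i ≤ cubeSide (F.P p.K).L θ.ν.M₂ (RkOfRecord (F.P p.K).L θ.ν.r (gOfRecord₁₃ F N θ.toStage13Params p i)) i) ∧
      (∀ i, 1 ≤ i → i ≤ k → (F.P p.K).L ^ i + (((F.P p.K).d + 4) * (F.P p.K).L + 2) * (∑ l ∈ Finset.range i, (F.P p.K).L ^ l) + 2 ≤
          cubeSide (F.P p.K).L θ.ν.M₂ (RkOfRecord (F.P p.K).L θ.ν.r (gOfRecord₁₃ F N θ.toStage13Params p i)) i) ∧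
      (∀ i, 1 ≤ i → i ≤ k → 0 < epsOfRecord θ.ν (gOfRecord₁₃ F N θ.toStage13Params p) i) ∧
      (∀ i, 1 ≤ i → i ≤ k → (143 * (((((F.P p.K).d + 4 : ℕ) : ℝ)) ^ 2 / 4) ^ 2) * epsOfRecord θ.ν (gOfRecord₁₃ F N θ.toStage13Params p) i ≤ 1 / 3) ∧
      (∀ i, 1 ≤ i → i ≤ k → 2 * epsOfRecord θ.ν (gOfRecord₁₃ F N θ.toStage13Params p) i ≤
          2 * ExpMeanLog.deltaSU (Fin N) / ((((F.P p.K).d + 4) * (F.P p.K).L : ℕ) : ℝ) ^ 2) := by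
  obtain ⟨⟨θ₁, Zr⟩, Zh, Phih⟩ := θ
  obtain rfl : θ₁ = _ := hθ
  set θ : Stage13HParams F N := ⟨⟨theta13LiveOfNumerics F N
      ({ stage12NumericsOfThm1CCMW F.L j γ ε₀ B₃ B₃' a₀ a₁ with s2 := { sect2NumericsOfThm1C F.L with cR := c } } : Stage12Numerics) ε₂₉ ζ Rz Zt, Zr⟩, Zh, Phih⟩ with hθdef
  have hγ1 : γ ≤ 1 := hγe.trans (Real.exp_lt_one_iff.mpr (by norm_num : (-1 : ℝ) < 0)).le
  have hA : 0 < θ.ν.A₀ := A0OfThm1CC1_pos hB hB' ha₀ ha₁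
  have hA16 : θ.ν.A₀ ≤ 1 / 16 := A0OfThm1CC1_le_one_div_sixteen hB hB' ha₀.le ha₁.le
  have hw' : Step.InInterval θ.γ k (gOfRecord₁₃ F N θ.toStage13Params p) := hw
  refine ⟨h3_of_ccmShape θ p rfl rfl rfl hγ1 h3γ hw', hR_of_ccmShape θ p rfl rfl hγ1 ?_ hw', hε_of_window θ p hA (hγe.trans_lt (Real.exp_lt_one_iff.mpr (by norm_num))) hw',
    hε3_of_ccmShape θ p rfl hA hA16 hγ0 hγe hε3γ hw', hε2_of_ccmShape θ p rfl hA hA16 hγe ?_ hw'⟩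
  · show ((8 * (F.P p.K).L + 3 : ℕ) : ℝ) ≤ (F.P p.K).L * Real.log (γ ^ 2)⁻¹
    rw [T4Family.P_L]; exact hRγ
  · show γ * Real.log (γ ^ 2)⁻¹ ≤ 16 * ExpMeanLog.deltaSU (Fin N) / ((((F.P p.K).d + 4) * (F.P p.K).L : ℕ) : ℝ) ^ 2
    rw [T4Family.P_d, T4Family.P_L]; exact hε2γ

end Letters

/-! ## §3  ★★★ N11's token `SupplyChainAt (gaussPinH θ) p` at the member from the key, the run's guard, K0's solvability and the supplier — nothing else -/

section Token

variable {F : T4Family} {N : ℕ} [NeZero N]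
variable {j : ℕ} {γ c ε₀ ε₂₉ B₃ B₃' a₀ a₁ : ℝ}
  {ζ : ZetaOfRecord F N (stage12NumericsOfThm1CCMW F.L j γ ε₀ B₃ B₃' a₀ a₁).ν (stage12NumericsOfThm1CCMW F.L j γ ε₀ B₃ B₃' a₀ a₁).τ9.M}
  {Rz : (K : ℕ) → Sect2.Residual (F.P K) (MatA N)} {Zt : (K : ℕ) → TkResidualW F N (FluctV N) K}
  {θ : Stage13HParams F N}

/-- **★★★ N11's ONE-TOKEN RESIDUAL ON THE K0-ROWS ROAD AT THE cR-LETTERED MEMBER, EVERY θ-LEVEL LETTER DISCHARGED**: for `θ` any H-extension of `θ₁₃(n_c, ε₂₉)`, `c ≥ 2`,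
`1 ≤ j`, `γ` meeting the four γ-conditions (`γ ≤ e^{−1}`, `3·L^j ≤ L·log γ⁻²`, `8L + 3 ≤ L·log γ⁻²`, `36608·γ·log γ⁻² ≤ 16∕3`, `γ·log γ⁻² ≤ 16·δ_N∕(8L)²`) and [15]'s
signs: on every run `p` in the window `]0, γ]`, from the key `θ.Provisos₁₃SepCoPH`, the run guard `PartCompat₁₃ … p p.K`, K0's per-cube [15]-solvability along the run and a
[III] §3 supplier at the certificate with `SupplierObligations ∧ SupplierBorel`, N11's token `SupplyChainAt (gaussPinH θ) p` (dag-n11-w1 ★★★ with `hcR`, `hM₁`, `hle`,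
admissibility, the five rows and the cube cover SUPPLIED here). [cite: Balaban1988Convergent, Thm 1 p.262, Theorem p.245, §3 p.279, (2.4)–(2.5) p.255, (2.10) p.256, (2.16)–(2.17) p.257, (3.24)–(3.25) p.270; Balaban1985Variational, Thm 1 (7)–(8) pp.278–279; Balaban1985Averaging, Prop. 2 p.26; Balaban1987RG1, Thm 1 p.259; Balaban1989LargeFieldI, (0.3)–(0.4) p.176] -/
theorem supplyChainAt_gaussPinH_of_ccmwCRH_of_supplierBorel_of_solvable
    (hθ : θ.toStage13Params = theta13LiveOfNumerics F N
      ({ stage12NumericsOfThm1CCMW F.L j γ ε₀ B₃ B₃' a₀ a₁ with s2 := { sect2NumericsOfThm1C F.L with cR := c } } : Stage12Numerics) ε₂₉ ζ Rz Zt)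
    (hc : 2 ≤ c) (hj : 1 ≤ j) (hε : 0 < ε₀) (hε' : 0 < ε₂₉) (hB : 0 ≤ B₃) (hB' : 0 ≤ B₃') (ha₀ : 0 < a₀) (ha₁ : 0 < a₁)
    (hγ0 : 0 < γ) (hγe : γ ≤ Real.exp (-1))
    (h3γ : 3 * (F.L : ℝ) ^ j ≤ F.L * Real.log (γ ^ 2)⁻¹) (hRγ : ((8 * F.L + 3 : ℕ) : ℝ) ≤ F.L * Real.log (γ ^ 2)⁻¹)
    (hε3γ : 36608 * (γ * Real.log (γ ^ 2)⁻¹) ≤ 16 / 3) (hε2γ : γ * Real.log (γ ^ 2)⁻¹ ≤ 16 * ExpMeanLog.deltaSU (Fin N) / ((8 * F.L : ℕ) : ℝ) ^ 2)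
    (h : θ.Provisos₁₃SepCoPH F N) (p : B12.RunParams)
    (hw : Step.InInterval γ p.K (gOfRecord₁₃ F N θ.toStage13Params p)) (hPC : PartCompat₁₃ F N θ.toStage13Params p p.K)
    (hsolv : ∀ i, 1 ≤ i → i ≤ p.K → ∀ (s : SeqOfRecord F θ.toStage13Params.ν θ.toStage13Params.τ9.M (gOfRecord₁₃ F N θ.toStage13Params p) p.K i) (V : GaugeField (F.P p.K) i (SU N)),
      chiSeqOfRecord F N θ.toStage13Params.ν θ.toStage13Params.τ9.M (gOfRecord₁₃ F N θ.toStage13Params p) p.K i s V ≠ 0 →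
      ∀ a ∈ cubesIn (fun a : ↥(cubeIndices (F.P p.K) (cubeSide (F.P p.K).L θ.toStage13Params.ν.M₂ (RkOfRecord (F.P p.K).L θ.toStage13Params.ν.r (gOfRecord₁₃ F N θ.toStage13Params p i)) i)) =>
          cubeEnl (F.P p.K) (cubeSide (F.P p.K).L θ.toStage13Params.ν.M₂ (RkOfRecord (F.P p.K).L θ.toStage13Params.ν.r (gOfRecord₁₃ F N θ.toStage13Params p i)) i) a 0) (s.Ω i),
        ∃ U₀, IsMinimizer (avOfRecord F N p.K) {U | PlaqSmall (θ.toStage13Params.ν.εreg * (F.P p.K).eta i ^ 2) U}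
          (Bj θ.toStage13Params.ν.M₁ (cubeEnl (F.P p.K) (cubeSide (F.P p.K).L θ.toStage13Params.ν.M₂ (RkOfRecord (F.P p.K).L θ.toStage13Params.ν.r (gOfRecord₁₃ F N θ.toStage13Params p i)) i) a 4) i)
          (avgFamily (avOfRecord F N p.K) (qsstarGIter0 i V)) U₀)
    (σ : Sect3Supplier (gaussPinH θ) p) (hσ : SupplierObligations (gaussPinH θ) p σ) (hσB : SupplierBorel (gaussPinH θ) p σ) :
    SupplyChainAt (gaussPinH θ) p := by
  obtain ⟨h3, hR, hεr, hε3, hε2⟩ := numericRows_of_ccmwCRH hθ hB hB' ha₀ ha₁ hγ0 hγe h3γ hRγ hε3γ hε2γ p hw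
  have hdiv := nesting_of_ccmwCRH hθ hj p
  have hcR := two_le_cR_of_ccmwCRH hθ hc
  obtain ⟨⟨θ₁, Zr⟩, Zh, Phih⟩ := θ
  obtain rfl : θ₁ = _ := hθ
  have hγ1 : γ < 1 := hγe.trans_lt (Real.exp_lt_one_iff.mpr (by norm_num))
  have hpos := ccmwCR_pos (L := F.L) (j := j) (ε₀ := ε₀) (B₃ := B₃) (B₃' := B₃') (a₀ := a₀) (a₁ := a₁) (by have := F.hL11; omega) hγ0 hγ1
    (by linarith : (0 : ℝ) < c) hε hB hB' ha₀ ha₁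
  have hadm := (admissible_theta13OfNumerics
    (n := ({ stage12NumericsOfThm1CCMW F.L j γ ε₀ B₃ B₃' a₀ a₁ with s2 := { sect2NumericsOfThm1C F.L with cR := c } } : Stage12Numerics))
    F N ζ Rz Zt hpos hε').liveRepin₁₃
  refine supplyChainAt_gaussPinH_of_supplierBorel_of_solvable _ p h hadm ?_ le_rfl hcR hw hPC h3 hR hεr hε3 hε2 hsolv
    (cover_row_of_partCompat_of_nesting _ p hdiv hPC) σ hσ hσB
  show 0 < F.L ^ j
  exact pow_pos (by have := F.hL11; omega) _

/-- **★★★ «γ SUFFICIENTLY SMALL» QUANTIFIED — N11's TOKEN ON THE K0-ROWS ROAD AT EVERY cR-LETTERED MEMBER `c ≥ 2`, EVERY WINDOW LETTER `γ ∈ ]0, γ₁₁ⁿᵘᵐ(L, j, N)]`**: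
there is an explicit `γ₁₁ⁿᵘᵐ > 0` (p608030 §1) such that for every such `γ`, `c`, every H-extension `θ` of `θ₁₃(n_c, ε₂₉)` and every run in the window, the token follows
from the key, the run guard, K0's solvability and the supplier — NOTHING ELSE. [cite: Balaban1988Convergent, Thm 1 p.262, Theorem p.245, §3 p.279, (2.4)–(2.5) p.255, (2.10) p.256; Balaban1987RG1, Thm 1 p.259; Balaban1985Variational, Thm 1 (7)–(8) pp.278–279; Balaban1985Averaging, Prop. 2 p.26] -/
theorem exists_window_supplyChainAt_gaussPinH_of_ccmwCRH (F : T4Family) (N : ℕ) [NeZero N] {j : ℕ} (hj : 1 ≤ j) :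
    ∃ γ₀ : ℝ, 0 < γ₀ ∧ ∀ (γ c ε₀ ε₂₉ B₃ B₃' a₀ a₁ : ℝ), 2 ≤ c → 0 < ε₀ → 0 < ε₂₉ → 0 ≤ B₃ → 0 ≤ B₃' → 0 < a₀ → 0 < a₁ → 0 < γ → γ ≤ γ₀ →
      ∀ (ζ : ZetaOfRecord F N (stage12NumericsOfThm1CCMW F.L j γ ε₀ B₃ B₃' a₀ a₁).ν (stage12NumericsOfThm1CCMW F.L j γ ε₀ B₃ B₃' a₀ a₁).τ9.M)
        (Rz : (K : ℕ) → Sect2.Residual (F.P K) (MatA N)) (Zt : (K : ℕ) → TkResidualW F N (FluctV N) K) (θ : Stage13HParams F N),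
        θ.toStage13Params = theta13LiveOfNumerics F N
          ({ stage12NumericsOfThm1CCMW F.L j γ ε₀ B₃ B₃' a₀ a₁ with s2 := { sect2NumericsOfThm1C F.L with cR := c } } : Stage12Numerics) ε₂₉ ζ Rz Zt →
        θ.Provisos₁₃SepCoPH F N → ∀ p : B12.RunParams,
        Step.InInterval γ p.K (gOfRecord₁₃ F N θ.toStage13Params p) → PartCompat₁₃ F N θ.toStage13Params p p.K →
        (∀ i, 1 ≤ i → i ≤ p.K → ∀ (s : SeqOfRecord F θ.toStage13Params.ν θ.toStage13Params.τ9.M (gOfRecord₁₃ F N θ.toStage13Params p) p.K i) (V : GaugeField (F.P p.K) i (SU N)),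
          chiSeqOfRecord F N θ.toStage13Params.ν θ.toStage13Params.τ9.M (gOfRecord₁₃ F N θ.toStage13Params p) p.K i s V ≠ 0 →
          ∀ a ∈ cubesIn (fun a : ↥(cubeIndices (F.P p.K) (cubeSide (F.P p.K).L θ.toStage13Params.ν.M₂ (RkOfRecord (F.P p.K).L θ.toStage13Params.ν.r (gOfRecord₁₃ F N θ.toStage13Params p i)) i)) =>
              cubeEnl (F.P p.K) (cubeSide (F.P p.K).L θ.toStage13Params.ν.M₂ (RkOfRecord (F.P p.K).L θ.toStage13Params.ν.r (gOfRecord₁₃ F N θ.toStage13Params p i)) i) a 0) (s.Ω i),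
            ∃ U₀, IsMinimizer (avOfRecord F N p.K) {U | PlaqSmall (θ.toStage13Params.ν.εreg * (F.P p.K).eta i ^ 2) U}
              (Bj θ.toStage13Params.ν.M₁ (cubeEnl (F.P p.K) (cubeSide (F.P p.K).L θ.toStage13Params.ν.M₂ (RkOfRecord (F.P p.K).L θ.toStage13Params.ν.r (gOfRecord₁₃ F N θ.toStage13Params p i)) i) a 4) i)
              (avgFamily (avOfRecord F N p.K) (qsstarGIter0 i V)) U₀) →
        ∀ σ : Sect3Supplier (gaussPinH θ) p, SupplierObligations (gaussPinH θ) p σ → SupplierBorel (gaussPinH θ) p σ → SupplyChainAt (gaussPinH θ) p := by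
  obtain ⟨γ₀, hγ₀, hall⟩ := exists_window_ccmShape (L := F.L) (by have := F.hL11; omega) j N
  refine ⟨γ₀, hγ₀, fun γ c ε₀ ε₂₉ B₃ B₃' a₀ a₁ hc hε hε' hB hB' ha₀ ha₁ hγ hγle ζ Rz Zt θ hθ h p hw hPC hsolv σ hσ hσB => ?_⟩
  obtain ⟨hγe, h3γ, hRγ, hε3γ, hε2γ⟩ := hall γ hγ hγle
  exact supplyChainAt_gaussPinH_of_ccmwCRH_of_supplierBorel_of_solvable hθ hc hj hε hε' hB hB' ha₀ ha₁ hγ hγe h3γ hRγ hε3γ hε2γ h p hw hPC hsolv σ hσ hσB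

/-- **★★★ THEOREM 1 OF [III] ALONG THE RUN AND THE THEOREM OF p. 245 IN LAW FORM — `∀ k ≤ K, SLaw₁₃CoPH (gaussPinH θ) p k` and `∀ k < K, SLaw → TLaw` — AT THE
cR-LETTERED MEMBER, PER RUN, FROM THE KEY, THE RUN GUARD, K0's SOLVABILITY AND THE SUPPLIER** (§3 ∘ dag-n11-e's `sLaw₁₃CoPH_all_of_supplyChainAt` ∕ `thmP245Laws_of_supplyChainAt`
on the live-selector line: selector clause `rfl`, `κ = 2·10⁴`, `E₀ = B₀ = 1`, `M = L^j ≥ 1` numerals) — the road-(b) twin, at a parameter where `2 ≤ cR` HOLDS, of dag-n11-e's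
road-(a) §3c deliverable at `θ₁₅ᶜᶜᴹᵂ`. [cite: Balaban1988Convergent, Thm 1 p.262, Theorem p.245, remark p.262, §3 p.279, (3.24)–(3.25) p.270, (2.10) p.256; Balaban1987RG1, Thm 1 p.259; Balaban1989LargeFieldI, (0.3)–(0.4) p.176, p.177 (i)–(ii)] -/
theorem thmP245Laws_gaussPinH_of_ccmwCRH_of_supplierBorel_of_solvable
    (hθ : θ.toStage13Params = theta13LiveOfNumerics F N
      ({ stage12NumericsOfThm1CCMW F.L j γ ε₀ B₃ B₃' a₀ a₁ with s2 := { sect2NumericsOfThm1C F.L with cR := c } } : Stage12Numerics) ε₂₉ ζ Rz Zt)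
    (hc : 2 ≤ c) (hj : 1 ≤ j) (hε : 0 < ε₀) (hε' : 0 < ε₂₉) (hB : 0 ≤ B₃) (hB' : 0 ≤ B₃') (ha₀ : 0 < a₀) (ha₁ : 0 < a₁)
    (hγ0 : 0 < γ) (hγe : γ ≤ Real.exp (-1))
    (h3γ : 3 * (F.L : ℝ) ^ j ≤ F.L * Real.log (γ ^ 2)⁻¹) (hRγ : ((8 * F.L + 3 : ℕ) : ℝ) ≤ F.L * Real.log (γ ^ 2)⁻¹)
    (hε3γ : 36608 * (γ * Real.log (γ ^ 2)⁻¹) ≤ 16 / 3) (hε2γ : γ * Real.log (γ ^ 2)⁻¹ ≤ 16 * ExpMeanLog.deltaSU (Fin N) / ((8 * F.L : ℕ) : ℝ) ^ 2)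
    (h : θ.Provisos₁₃SepCoPH F N) (p : B12.RunParams)
    (hw : Step.InInterval γ p.K (gOfRecord₁₃ F N θ.toStage13Params p)) (hPC : PartCompat₁₃ F N θ.toStage13Params p p.K)
    (hsolv : ∀ i, 1 ≤ i → i ≤ p.K → ∀ (s : SeqOfRecord F θ.toStage13Params.ν θ.toStage13Params.τ9.M (gOfRecord₁₃ F N θ.toStage13Params p) p.K i) (V : GaugeField (F.P p.K) i (SU N)),
      chiSeqOfRecord F N θ.toStage13Params.ν θ.toStage13Params.τ9.M (gOfRecord₁₃ F N θ.toStage13Params p) p.K i s V ≠ 0 →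
      ∀ a ∈ cubesIn (fun a : ↥(cubeIndices (F.P p.K) (cubeSide (F.P p.K).L θ.toStage13Params.ν.M₂ (RkOfRecord (F.P p.K).L θ.toStage13Params.ν.r (gOfRecord₁₃ F N θ.toStage13Params p i)) i)) =>
          cubeEnl (F.P p.K) (cubeSide (F.P p.K).L θ.toStage13Params.ν.M₂ (RkOfRecord (F.P p.K).L θ.toStage13Params.ν.r (gOfRecord₁₃ F N θ.toStage13Params p i)) i) a 0) (s.Ω i),
        ∃ U₀, IsMinimizer (avOfRecord F N p.K) {U | PlaqSmall (θ.toStage13Params.ν.εreg * (F.P p.K).eta i ^ 2) U}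
          (Bj θ.toStage13Params.ν.M₁ (cubeEnl (F.P p.K) (cubeSide (F.P p.K).L θ.toStage13Params.ν.M₂ (RkOfRecord (F.P p.K).L θ.toStage13Params.ν.r (gOfRecord₁₃ F N θ.toStage13Params p i)) i) a 4) i)
          (avgFamily (avOfRecord F N p.K) (qsstarGIter0 i V)) U₀)
    (σ : Sect3Supplier (gaussPinH θ) p) (hσ : SupplierObligations (gaussPinH θ) p σ) (hσB : SupplierBorel (gaussPinH θ) p σ) :
    (∀ k, k ≤ p.K → SLaw₁₃CoPH F N (gaussPinH θ) p k) ∧ (∀ k, k < p.K → SLaw₁₃CoPH F N (gaussPinH θ) p k → TLaw₁₃CoPH F N (gaussPinH θ) p k) := by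
  have hN := supplyChainAt_gaussPinH_of_ccmwCRH_of_supplierBorel_of_solvable hθ hc hj hε hε' hB hB' ha₀ ha₁ hγ0 hγe h3γ hRγ hε3γ hε2γ h p hw hPC hsolv σ hσ hσB
  obtain ⟨⟨θ₁, Zr⟩, Zh, Phih⟩ := θ
  obtain rfl : θ₁ = _ := hθ
  have hγ1 : γ < 1 := hγe.trans_lt (Real.exp_lt_one_iff.mpr (by norm_num))
  have hpos := ccmwCR_pos (L := F.L) (j := j) (ε₀ := ε₀) (B₃ := B₃) (B₃' := B₃') (a₀ := a₀) (a₁ := a₁) (by have := F.hL11; omega) hγ0 hγ1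
    (by linarith : (0 : ℝ) < c) hε hB hB' ha₀ ha₁
  have hadm := (admissible_theta13OfNumerics
    (n := ({ stage12NumericsOfThm1CCMW F.L j γ ε₀ B₃ B₃' a₀ a₁ with s2 := { sect2NumericsOfThm1C F.L with cR := c } } : Stage12Numerics))
    F N ζ Rz Zt hpos hε').liveRepin₁₃
  have hrec := provisos₁₃CoPH_gaussPinH h.toCore
  have hM : 1 ≤ F.L ^ j := Nat.one_le_pow _ _ (by have := F.hL11; omega)
  have hκ : (0 : ℝ) ≤ 20000 := by norm_num
  exact ⟨sLaw₁₃CoPH_all_of_supplyChainAt hrec rfl hadm hκ zero_le_one zero_le_one hM hN,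
    thmP245Laws_of_supplyChainAt hrec rfl hadm hκ zero_le_one zero_le_one hM hN⟩

end Token

end Summit.QuantumFields.YangMills.Theorems.BalabanUVNodesN11SupplyChainAtCRLetteredNumerics

end
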